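import Mathlib
import Literature.Analysis.Complex.LocalCrossTheorem
import Summits.QuantumFields.YangMills.Theorems.F4SubCurvatureDoorPlanarFrameTimeHolomorphy
import HarnessLib

/-!
# Rung R1⁺ «PlanarConicChart» of LINE g20-A «angular type», part 1/2: the two-frame conic chart
# (planner ym-idea-3 g20, crux ⟨stmt-QuantumFields-23035⟩ `F4SubCurvatureDoor.ShortRootRigidity`; owner file
# `Cruxes/ShortRootRigidity/Lines/angular_type_rungs.lean`)

Free-hands work of the LEAD seat ym-line-sfw-p2 (gen 74).  The frame-independent core of R1⁺ (`conicChart_of_two_frames`):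
for two unit directions `n₁, n₂` with `|⟪n₁, n₂⟫| ≤ ½`, rung R0 in both frames (hypotheses, direction-vector form), explicit
dual coefficients, and `y ≠ 0` with both frame components `≥ ‖y‖/2`, the kernel is on the real points of the polydisc of
radius `c‖y‖` around `y` (`c := min ⅛ (r(¼)/4)`, `r(¼)` = Bernstein's local-cross radius, universal) the trace of ONE
holomorphic function bounded by any bound of `|k|` on `{‖y'‖ ≥ c‖y‖}`: the slices of `P(s, t, z) := k(y + ‖y‖(s n₁ + t n₂))`
(dummy `z`) are holomorphic on the disc of radius `¼` with the axis bound (`slice_extension`), Bernstein's local cross theorem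
`Literature.Analysis.Complex.exists_holomorphic_extension_of_separately_three_local` joins them, the complex-affine chart pulls
back.  Also: the bound of `|k|` off any ball and the dual coefficients of the three frame pairs (the 60° case split itself is
`…F4SubCurvatureDoorPlanarFrames.exists_good_pair`, reused in part 2).
HONEST LABEL: helper lemmas toward the budget-free rung R1⁺ of an OPEN line; (C) `PlanarSpectralCone`, (A), the crux, every
rung of LADDER-YM and every summit are untouched; the Yang–Mills mass gap is NOT proved by this.
-/

noncomputable section

namespace Summit.QuantumFields.YangMills.Cruxes.ShortRootRigidity.AngularTypeRungs

open scoped Topology InnerProductSpace BigOperators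
open Set Metric
open Literature.Analysis.Complex (exists_holomorphic_extension_of_separately_three_local)
open Summit.QuantumFields.YangMills.Theorems.F4SubCurvatureDoorSliceDensityRegistered (E2)
open Summit.QuantumFields.YangMills.Theorems.F4SubCurvatureDoorSliceInClassRegistered (InPlanarClass)

variable {k : E2 → ℝ}

/-- `⟪x, n₋⟫ = x₀/2 − (√3/2) x₁`. -/
theorem inner_hexNormal' (x : E2) :
    ⟪x, mk2 (1 / 2) (-(Real.sqrt 3 / 2))⟫_ℝ = x 0 / 2 - Real.sqrt 3 / 2 * x 1 := by
  rw [EuclideanSpace.inner_eq_star_dotProduct]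
  simp [Fin.sum_univ_two, dotProduct, mk2]
  ring

/-- `n₋` has unit norm. -/
theorem norm_hexNormal' : ‖mk2 (1 / 2) (-(Real.sqrt 3 / 2))‖ = 1 := by
  have h3 : Real.sqrt 3 ^ 2 = 3 := Real.sq_sqrt (by norm_num)
  have hsq : ‖mk2 (1 / 2) (-(Real.sqrt 3 / 2))‖ ^ 2 = 1 := by
    rw [EuclideanSpace.real_norm_sq_eq, Fin.sum_univ_two, mk2_apply_zero, mk2_apply_one]
    nlinarith [h3]
  have h0 : 0 ≤ ‖mk2 (1 / 2) (-(Real.sqrt 3 / 2))‖ := norm_nonneg _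
  nlinarith [hsq, h0]

/-- `e₀` has unit norm. -/
theorem norm_single_zero : ‖(EuclideanSpace.single 0 (1 : ℝ) : E2)‖ = 1 := by simp

/-- A planar-class kernel is bounded on `{‖y‖ ≥ ρ}` for every `ρ > 0` (continuity off `0` on the compact annulus
`ρ ≤ ‖y‖ ≤ 1` + the class bound outside the unit disc). -/
theorem exists_bound_off_ball (hk : InPlanarClass k) {ρ : ℝ} (hρ : 0 < ρ) :
    ∃ M : ℝ, ∀ y : E2, ρ ≤ ‖y‖ → |k y| ≤ M := by
  obtain ⟨C, hC⟩ := hk.2.1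
  set A : Set E2 := Metric.closedBall 0 1 \ Metric.ball 0 ρ with hA
  have hAc : IsCompact A := (isCompact_closedBall (0 : E2) 1).diff Metric.isOpen_ball
  have hA0 : A ⊆ {x | x ≠ 0} := by
    intro x hx h0
    have h1 : x ∉ Metric.ball (0 : E2) ρ := hx.2
    rw [h0] at h1
    exact h1 (Metric.mem_ball_self hρ)
  obtain ⟨M₁, hM₁⟩ := hAc.exists_bound_of_continuousOn (hk.1.mono hA0)
  refine ⟨max M₁ C, fun x hx => ?_⟩
  by_cases h1 : ‖x‖ ≤ 1
  · have hxA : x ∈ A := by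
      refine ⟨by rwa [Metric.mem_closedBall, dist_zero_right], fun h => ?_⟩
      rw [Metric.mem_ball, dist_zero_right] at h
      linarith
    have := hM₁ x hxA
    rw [Real.norm_eq_abs] at this
    exact this.trans (le_max_left _ _)
  · exact (hC x (le_of_not_ge h1)).trans (le_max_right _ _)

/-- **Slice extension.**  `n` a unit direction, `|⟪m, n⟫| ≤ ½`, R0 in the frame `n` (hypothesis `hR0`), `y ≠ 0` with
`|⟪y, n⟫| ≥ ‖y‖/2`, `c ≤ ⅛`, `M` a bound of `|k|` on `{‖y'‖ ≥ c‖y‖}`, `|t| < ¼`: the slice `s ↦ k(y + ‖y‖(s n + t m))` is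
on `(−¼, ¼)` the trace of a function holomorphic on the disc of radius `¼` bounded by `M` (the frame disc at the base point
`y + ‖y‖ t m` has radius `|⟪y, n⟫ + ‖y‖ t ⟪m, n⟫| ≥ 3‖y‖/8`; the axis points have norm `≥ ‖y‖/8 ≥ c‖y‖`). -/
theorem slice_extension {n m : E2} (hn : ‖n‖ = 1) (hmn : |⟪m, n⟫_ℝ| ≤ 1 / 2)
    (hR0 : ∀ x : E2, ⟪x, n⟫_ℝ ≠ 0 →
      ∃ g : ℂ → ℂ, DifferentiableOn ℂ g (ball (0 : ℂ) |⟪x, n⟫_ℝ|) ∧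
        (∀ u : ℝ, |u| < |⟪x, n⟫_ℝ| → g u = k (x + u • n)) ∧
        ∀ w ∈ ball (0 : ℂ) |⟪x, n⟫_ℝ|, ‖g w‖ ≤ k ((⟪x, n⟫_ℝ + w.re) • n))
    {y : E2} (hy : y ≠ 0) (hyn : ‖y‖ / 2 ≤ |⟪y, n⟫_ℝ|)
    {c : ℝ} (hc : c ≤ 1 / 8) {M : ℝ} (hM : ∀ y' : E2, c * ‖y‖ ≤ ‖y'‖ → |k y'| ≤ M)
    (t : ℝ) (ht : |t| < 1 / 4) :
    ∃ g : ℂ → ℂ, DifferentiableOn ℂ g (ball (0 : ℂ) (1 / 4)) ∧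
      (∀ w ∈ ball (0 : ℂ) (1 / 4), ‖g w‖ ≤ M) ∧
      ∀ s : ℝ, |s| < 1 / 4 → g s = ((k (y + ‖y‖ • (s • n + t • m)) : ℝ) : ℂ) := by
  have hy0 : 0 < ‖y‖ := norm_pos_iff.mpr hy
  set y' : E2 := y + (‖y‖ * t) • m with hy'
  have hin : ⟪y', n⟫_ℝ = ⟪y, n⟫_ℝ + ‖y‖ * t * ⟪m, n⟫_ℝ := by
    rw [hy', inner_add_left, real_inner_smul_left]
  have htm : |t| * |⟪m, n⟫_ℝ| ≤ 1 / 8 := by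
    have := mul_le_mul (le_of_lt ht) hmn (abs_nonneg _) (by norm_num : (0 : ℝ) ≤ 1 / 4)
    linarith
  have h1 : |‖y‖ * t * ⟪m, n⟫_ℝ| ≤ ‖y‖ / 8 := by
    rw [abs_mul, abs_mul, abs_of_pos hy0, mul_assoc]
    have := mul_le_mul_of_nonneg_left htm hy0.le
    linarith
  have hlow : 3 * ‖y‖ / 8 ≤ |⟪y', n⟫_ℝ| := by
    have h2 := abs_sub_abs_le_abs_sub ⟪y, n⟫_ℝ (-(‖y‖ * t * ⟪m, n⟫_ℝ))
    rw [sub_neg_eq_add, abs_neg, ← hin] at h2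
    linarith
  have hne : ⟪y', n⟫_ℝ ≠ 0 := by
    intro h
    rw [h, abs_zero] at hlow
    linarith
  obtain ⟨g₁, hg₁d, hg₁r, hg₁b⟩ := hR0 y' hne
  have hmaps : MapsTo (fun w : ℂ => (‖y‖ : ℂ) * w) (ball (0 : ℂ) (1 / 4)) (ball (0 : ℂ) |⟪y', n⟫_ℝ|) := by
    intro w hw
    rw [mem_ball_zero_iff] at hw ⊢
    rw [norm_mul, Complex.norm_real, Real.norm_eq_abs, abs_of_pos hy0]
    nlinarith
  have hdm : DifferentiableOn ℂ (fun w : ℂ => (‖y‖ : ℂ) * w) (ball (0 : ℂ) (1 / 4)) := by fun_prop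
  refine ⟨fun w => g₁ ((‖y‖ : ℂ) * w), hg₁d.comp hdm hmaps, fun w hw => ?_, fun s hs => ?_⟩
  · show ‖g₁ ((‖y‖ : ℂ) * w)‖ ≤ M
    have hb := hg₁b _ (hmaps hw)
    rw [Complex.re_ofReal_mul] at hb
    refine hb.trans ?_
    have hwre : |w.re| < 1 / 4 := (Complex.abs_re_le_norm w).trans_lt (by rwa [mem_ball_zero_iff] at hw)
    have ha : ‖y‖ / 8 ≤ |⟪y', n⟫_ℝ + ‖y‖ * w.re| := by
      have h2 := abs_sub_abs_le_abs_sub ⟪y', n⟫_ℝ (-(‖y‖ * w.re))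
      rw [sub_neg_eq_add, abs_neg, abs_mul, abs_of_pos hy0] at h2
      nlinarith
    have hnorm : c * ‖y‖ ≤ ‖(⟪y', n⟫_ℝ + ‖y‖ * w.re) • n‖ := by
      rw [norm_smul, Real.norm_eq_abs, hn, mul_one]
      nlinarith
    exact (le_abs_self _).trans (hM _ hnorm)
  · show g₁ ((‖y‖ : ℂ) * (s : ℂ)) = _
    have hs' : |‖y‖ * s| < |⟪y', n⟫_ℝ| := by
      rw [abs_mul, abs_of_pos hy0]
      nlinarith
    rw [← Complex.ofReal_mul, hg₁r _ hs']
    have hv : y' + (‖y‖ * s) • n = y + ‖y‖ • (s • n + t • m) := by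
      rw [hy', smul_add, smul_smul, smul_smul]
      abel
    rw [hv]

/-- Bernstein's local-cross radius `r(¼)` (from `exists_holomorphic_extension_of_separately_three_local` at `ℓ = ¼`;
depends on nothing). [problem-side definition] -/
def crossRadius : ℝ :=
  Classical.choose (exists_holomorphic_extension_of_separately_three_local (1 / 4) (by norm_num))

/-- `r(¼) > 0`. -/
theorem crossRadius_pos : 0 < crossRadius :=
  (Classical.choose_spec (exists_holomorphic_extension_of_separately_three_local (1 / 4) (by norm_num))).1

/-- The conic constant `c := min ⅛ (r(¼)/4)` (universal). [problem-side definition] -/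
def conicConst : ℝ := min (1 / 8) (crossRadius / 4)

/-- `c > 0`. -/
theorem conicConst_pos : 0 < conicConst :=
  lt_min (by norm_num) (by have := crossRadius_pos; positivity)

/-- `c ≤ ⅛`. -/
theorem conicConst_le_eighth : conicConst ≤ 1 / 8 := min_le_left _ _

/-- `c ≤ r(¼)/4`. -/
theorem conicConst_le_quarter_radius : conicConst ≤ crossRadius / 4 := min_le_right _ _

/-! ## The chart from two good frames -/

/-- **The conic chart from two good frames.**  `n₁, n₂` unit directions with `|⟪n₁, n₂⟫| ≤ ½` and R0 in both frames,
explicit dual coefficients (`v = (a₁v₀ + b₁v₁) n₁ + (a₂v₀ + b₂v₁) n₂`, `|aᵢ| + |bᵢ| ≤ 2`), `y ≠ 0` with both frame components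
`≥ ‖y‖/2`, and `M` a bound of `|k|` on `{‖y'‖ ≥ c‖y‖}`: the kernel is on the real points of the polydisc of radius `c‖y‖`
around `y` the trace of a function holomorphic there and bounded by `M` (slices by `slice_extension`, joint extension by
Bernstein's local cross theorem with a dummy third variable, pulled back along the complex-affine chart). -/
theorem conicChart_of_two_frames {n₁ n₂ : E2} (hn₁ : ‖n₁‖ = 1) (hn₂ : ‖n₂‖ = 1)
    (h12 : |⟪n₁, n₂⟫_ℝ| ≤ 1 / 2)
    (hF₁ : ∀ x : E2, ⟪x, n₁⟫_ℝ ≠ 0 →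
      ∃ g : ℂ → ℂ, DifferentiableOn ℂ g (ball (0 : ℂ) |⟪x, n₁⟫_ℝ|) ∧
        (∀ u : ℝ, |u| < |⟪x, n₁⟫_ℝ| → g u = k (x + u • n₁)) ∧
        ∀ w ∈ ball (0 : ℂ) |⟪x, n₁⟫_ℝ|, ‖g w‖ ≤ k ((⟪x, n₁⟫_ℝ + w.re) • n₁))
    (hF₂ : ∀ x : E2, ⟪x, n₂⟫_ℝ ≠ 0 →
      ∃ g : ℂ → ℂ, DifferentiableOn ℂ g (ball (0 : ℂ) |⟪x, n₂⟫_ℝ|) ∧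
        (∀ u : ℝ, |u| < |⟪x, n₂⟫_ℝ| → g u = k (x + u • n₂)) ∧
        ∀ w ∈ ball (0 : ℂ) |⟪x, n₂⟫_ℝ|, ‖g w‖ ≤ k ((⟪x, n₂⟫_ℝ + w.re) • n₂))
    (a₁ b₁ a₂ b₂ : ℝ) (hdual : ∀ v : E2, (a₁ * v 0 + b₁ * v 1) • n₁ + (a₂ * v 0 + b₂ * v 1) • n₂ = v)
    (h₁ : |a₁| + |b₁| ≤ 2) (h₂ : |a₂| + |b₂| ≤ 2)
    {y : E2} (hy : y ≠ 0) (hy₁ : ‖y‖ / 2 ≤ |⟪y, n₁⟫_ℝ|) (hy₂ : ‖y‖ / 2 ≤ |⟪y, n₂⟫_ℝ|)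
    {M : ℝ} (hM : ∀ y' : E2, conicConst * ‖y‖ ≤ ‖y'‖ → |k y'| ≤ M) :
    ∃ F : ℂ × ℂ → ℂ,
      DifferentiableOn ℂ F (ball ((((y 0 : ℝ) : ℂ), ((y 1 : ℝ) : ℂ)) : ℂ × ℂ) (conicConst * ‖y‖)) ∧
      (∀ a b : ℝ, |a - y 0| < conicConst * ‖y‖ → |b - y 1| < conicConst * ‖y‖ →
        F ((a : ℂ), (b : ℂ)) = k (mk2 a b)) ∧
      ∀ w ∈ ball ((((y 0 : ℝ) : ℂ), ((y 1 : ℝ) : ℂ)) : ℂ × ℂ) (conicConst * ‖y‖), ‖F w‖ ≤ M := by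
  have hy0 : 0 < ‖y‖ := norm_pos_iff.mpr hy
  have hr := crossRadius_pos
  have hcross :=
    (Classical.choose_spec (exists_holomorphic_extension_of_separately_three_local (1 / 4) (by norm_num))).2
  have h21 : |⟪n₂, n₁⟫_ℝ| ≤ 1 / 2 := by rwa [real_inner_comm]
  -- the function of three real variables (dummy third variable)
  set P : ℝ → ℝ → ℝ → ℂ := fun s t _ => ((k (y + ‖y‖ • (s • n₁ + t • n₂)) : ℝ) : ℂ) with hP
  have hs1 : ∀ t z : ℝ, |t| < 1 / 4 → |z| < 1 / 4 → ∃ g : ℂ → ℂ, DifferentiableOn ℂ g (ball (0 : ℂ) (1 / 4)) ∧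
      (∀ w ∈ ball (0 : ℂ) (1 / 4), ‖g w‖ ≤ M) ∧ ∀ s : ℝ, |s| < 1 / 4 → g s = P s t z :=
    fun t z ht _ => slice_extension hn₁ h21 hF₁ hy hy₁ conicConst_le_eighth hM t ht
  have hs2 : ∀ s z : ℝ, |s| < 1 / 4 → |z| < 1 / 4 → ∃ g : ℂ → ℂ, DifferentiableOn ℂ g (ball (0 : ℂ) (1 / 4)) ∧
      (∀ w ∈ ball (0 : ℂ) (1 / 4), ‖g w‖ ≤ M) ∧ ∀ t : ℝ, |t| < 1 / 4 → g t = P s t z := by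
    intro s z hs _
    obtain ⟨g, hgd, hgb, hgr⟩ := slice_extension hn₂ h12 hF₂ hy hy₂ conicConst_le_eighth hM s hs
    refine ⟨g, hgd, hgb, fun t ht => ?_⟩
    rw [hgr t ht, add_comm (t • n₂)]
  have hs3 : ∀ s t : ℝ, |s| < 1 / 4 → |t| < 1 / 4 → ∃ g : ℂ → ℂ, DifferentiableOn ℂ g (ball (0 : ℂ) (1 / 4)) ∧
      (∀ w ∈ ball (0 : ℂ) (1 / 4), ‖g w‖ ≤ M) ∧ ∀ z : ℝ, |z| < 1 / 4 → g z = P s t z := by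
    intro s t hs ht
    have hPM : ‖P s t 0‖ ≤ M := by
      obtain ⟨g, -, hgb, hgr⟩ := hs1 t 0 ht (by norm_num)
      rw [← hgr s hs]
      exact hgb _ (by rwa [mem_ball_zero_iff, Complex.norm_real, Real.norm_eq_abs])
    exact ⟨fun _ => P s t 0, differentiableOn_const _, fun w _ => hPM, fun z _ => rfl⟩
  obtain ⟨G, hGd, hGb, hGr⟩ := hcross M P hs1 hs2 hs3
  -- the complex-affine chart
  have hcoord : ∀ (a b : ℝ) (w : ℂ × ℂ), |a| + |b| ≤ 2 →
      w ∈ ball ((((y 0 : ℝ) : ℂ), ((y 1 : ℝ) : ℂ)) : ℂ × ℂ) (conicConst * ‖y‖) →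
      ‖((a : ℂ) * (w.1 - (y 0 : ℂ)) + (b : ℂ) * (w.2 - (y 1 : ℂ))) / (‖y‖ : ℂ)‖ < crossRadius := by
    intro a b w hab hw
    rw [mem_ball, Prod.dist_eq, max_lt_iff, dist_eq_norm, dist_eq_norm] at hw
    rw [norm_div, Complex.norm_real, Real.norm_eq_abs, abs_of_pos hy0, div_lt_iff₀ hy0]
    have e1 : ‖(a : ℂ) * (w.1 - (y 0 : ℂ)) + (b : ℂ) * (w.2 - (y 1 : ℂ))‖ ≤
        |a| * ‖w.1 - (y 0 : ℂ)‖ + |b| * ‖w.2 - (y 1 : ℂ)‖ := by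
      refine (norm_add_le _ _).trans ?_
      rw [norm_mul, norm_mul, Complex.norm_real, Complex.norm_real, Real.norm_eq_abs, Real.norm_eq_abs]
    have e2 : |a| * ‖w.1 - (y 0 : ℂ)‖ + |b| * ‖w.2 - (y 1 : ℂ)‖ ≤ (|a| + |b|) * (conicConst * ‖y‖) := by
      rw [add_mul]
      exact add_le_add (mul_le_mul_of_nonneg_left hw.1.le (abs_nonneg a))
        (mul_le_mul_of_nonneg_left hw.2.le (abs_nonneg b))
    have e3 : (|a| + |b|) * (conicConst * ‖y‖) ≤ 2 * (crossRadius / 4 * ‖y‖) :=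
      mul_le_mul hab (mul_le_mul_of_nonneg_right conicConst_le_quarter_radius hy0.le)
        (mul_nonneg conicConst_pos.le (norm_nonneg _)) (by norm_num)
    nlinarith
  have hA : ∀ a b : ℝ, Differentiable ℂ
      (fun w : ℂ × ℂ => ((a : ℂ) * (w.1 - (y 0 : ℂ)) + (b : ℂ) * (w.2 - (y 1 : ℂ))) / (‖y‖ : ℂ)) := by
    intro a b
    fun_prop
  have hmaps : MapsTo
      (fun w : ℂ × ℂ => ((((a₁ : ℂ) * (w.1 - (y 0 : ℂ)) + (b₁ : ℂ) * (w.2 - (y 1 : ℂ))) / (‖y‖ : ℂ),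
        ((a₂ : ℂ) * (w.1 - (y 0 : ℂ)) + (b₂ : ℂ) * (w.2 - (y 1 : ℂ))) / (‖y‖ : ℂ), (0 : ℂ)) : ℂ × ℂ × ℂ))
      (ball ((((y 0 : ℝ) : ℂ), ((y 1 : ℝ) : ℂ)) : ℂ × ℂ) (conicConst * ‖y‖))
      {p : ℂ × ℂ × ℂ | ‖p.1‖ < crossRadius ∧ ‖p.2.1‖ < crossRadius ∧ ‖p.2.2‖ < crossRadius} :=
    fun w hw => ⟨hcoord a₁ b₁ w h₁ hw, hcoord a₂ b₂ w h₂ hw, by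
      show ‖(0 : ℂ)‖ < crossRadius
      rw [norm_zero]; exact hr⟩
  refine ⟨fun w => G ((((a₁ : ℂ) * (w.1 - (y 0 : ℂ)) + (b₁ : ℂ) * (w.2 - (y 1 : ℂ))) / (‖y‖ : ℂ),
      ((a₂ : ℂ) * (w.1 - (y 0 : ℂ)) + (b₂ : ℂ) * (w.2 - (y 1 : ℂ))) / (‖y‖ : ℂ), (0 : ℂ))),
    hGd.comp (fun w _ => ?_) hmaps, fun a b ha hb => ?_, fun w hw => ?_⟩
  · exact (((hA a₁ b₁) w).prodMk (((hA a₂ b₂) w).prodMk (differentiableAt_const _))).differentiableWithinAt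
  · -- real points
    set s : ℝ := (a₁ * (a - y 0) + b₁ * (b - y 1)) / ‖y‖ with hs_def
    set t : ℝ := (a₂ * (a - y 0) + b₂ * (b - y 1)) / ‖y‖ with ht_def
    have hw : (((a : ℂ), (b : ℂ)) : ℂ × ℂ) ∈ ball ((((y 0 : ℝ) : ℂ), ((y 1 : ℝ) : ℂ)) : ℂ × ℂ) (conicConst * ‖y‖) := by
      rw [mem_ball, Prod.dist_eq, max_lt_iff]
      constructor
      · show dist (a : ℂ) ((y 0 : ℝ) : ℂ) < _
        rw [dist_eq_norm, ← Complex.ofReal_sub, Complex.norm_real, Real.norm_eq_abs]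
        exact ha
      · show dist (b : ℂ) ((y 1 : ℝ) : ℂ) < _
        rw [dist_eq_norm, ← Complex.ofReal_sub, Complex.norm_real, Real.norm_eq_abs]
        exact hb
    have e1 : ((a₁ : ℂ) * ((a : ℂ) - (y 0 : ℂ)) + (b₁ : ℂ) * ((b : ℂ) - (y 1 : ℂ))) / (‖y‖ : ℂ) = (s : ℂ) := by
      rw [hs_def]; push_cast; ring
    have e2 : ((a₂ : ℂ) * ((a : ℂ) - (y 0 : ℂ)) + (b₂ : ℂ) * ((b : ℂ) - (y 1 : ℂ))) / (‖y‖ : ℂ) = (t : ℂ) := by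
      rw [ht_def]; push_cast; ring
    have hs : |s| < crossRadius := by
      have h := hcoord a₁ b₁ _ h₁ hw
      dsimp only at h
      rwa [e1, Complex.norm_real, Real.norm_eq_abs] at h
    have ht : |t| < crossRadius := by
      have h := hcoord a₂ b₂ _ h₂ hw
      dsimp only at h
      rwa [e2, Complex.norm_real, Real.norm_eq_abs] at h
    have hG := hGr s t 0 hs ht (by rw [abs_zero]; exact hr)
    rw [Complex.ofReal_zero] at hG
    show G (((a₁ : ℂ) * ((a : ℂ) - (y 0 : ℂ)) + (b₁ : ℂ) * ((b : ℂ) - (y 1 : ℂ))) / (‖y‖ : ℂ),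
      ((a₂ : ℂ) * ((a : ℂ) - (y 0 : ℂ)) + (b₂ : ℂ) * ((b : ℂ) - (y 1 : ℂ))) / (‖y‖ : ℂ), (0 : ℂ)) = _
    rw [e1, e2, hG, hP]
    dsimp only
    have hv := hdual (mk2 a b - y)
    simp only [PiLp.sub_apply, mk2_apply_zero, mk2_apply_one] at hv
    have hsc : ‖y‖ * s = a₁ * (a - y 0) + b₁ * (b - y 1) := by rw [hs_def]; field_simp
    have htc : ‖y‖ * t = a₂ * (a - y 0) + b₂ * (b - y 1) := by rw [ht_def]; field_simp
    have hvec : y + ‖y‖ • (s • n₁ + t • n₂) = mk2 a b := by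
      rw [smul_add, smul_smul, smul_smul, hsc, htc, hv]
      abel
    rw [hvec]
  · have hw' := hmaps hw
    beta_reduce
    exact hGb _ hw'.1 hw'.2.1 hw'.2.2

/-! ## Dual coefficients of the three frame pairs -/

/-- Dual coefficients of the frame pair `(e₀, n₊)`: `v = (v₀ − (√3/3)v₁) e₀ + (2√3/3) v₁ n₊`. -/
theorem dual_zero_sixty (v : E2) :
    (1 * v 0 + -(Real.sqrt 3 / 3) * v 1) • (EuclideanSpace.single 0 (1 : ℝ) : E2) +
      (0 * v 0 + 2 * Real.sqrt 3 / 3 * v 1) • mk2 (1 / 2) (Real.sqrt 3 / 2) = v := by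
  have h3 : Real.sqrt 3 * Real.sqrt 3 = 3 := Real.mul_self_sqrt (by norm_num)
  ext i
  fin_cases i
  · simp [mk2]
    ring
  · simp [mk2]
    linear_combination (v 1 / 3) * h3

/-- Dual coefficients of the frame pair `(e₀, n₋)`: `v = (v₀ + (√3/3)v₁) e₀ − (2√3/3) v₁ n₋`. -/
theorem dual_zero_negSixty (v : E2) :
    (1 * v 0 + Real.sqrt 3 / 3 * v 1) • (EuclideanSpace.single 0 (1 : ℝ) : E2) +
      (0 * v 0 + -(2 * Real.sqrt 3 / 3) * v 1) • mk2 (1 / 2) (-(Real.sqrt 3 / 2)) = v := by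
  have h3 : Real.sqrt 3 * Real.sqrt 3 = 3 := Real.mul_self_sqrt (by norm_num)
  ext i
  fin_cases i
  · simp [mk2]
    ring
  · simp [mk2]
    linear_combination (v 1 / 3) * h3

/-- Dual coefficients of the frame pair `(n₊, n₋)`: `v = (v₀ + (√3/3)v₁) n₊ + (v₀ − (√3/3)v₁) n₋`. -/
theorem dual_sixty_negSixty (v : E2) :
    (1 * v 0 + Real.sqrt 3 / 3 * v 1) • mk2 (1 / 2) (Real.sqrt 3 / 2) +
      (1 * v 0 + -(Real.sqrt 3 / 3) * v 1) • mk2 (1 / 2) (-(Real.sqrt 3 / 2)) = v := by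
  have h3 : Real.sqrt 3 * Real.sqrt 3 = 3 := Real.mul_self_sqrt (by norm_num)
  ext i
  fin_cases i
  · simp [mk2]
    ring
  · simp [mk2]
    linear_combination (v 1 / 3) * h3

/-- `|1| + |−√3/3| ≤ 2` and its sign variants. -/
theorem abs_coeff_le_two (ε : ℝ) (hε : ε = 1 ∨ ε = -1) : |(1 : ℝ)| + |ε * (Real.sqrt 3 / 3)| ≤ 2 := by
  have h3 : Real.sqrt 3 * Real.sqrt 3 = 3 := Real.mul_self_sqrt (by norm_num)
  have h1 : (1 : ℝ) ≤ Real.sqrt 3 := by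
    rw [show (1 : ℝ) = Real.sqrt 1 by simp]
    exact Real.sqrt_le_sqrt (by norm_num)
  have hε1 : |ε| = 1 := by rcases hε with h | h <;> simp [h]
  rw [abs_one, abs_mul, hε1, one_mul, abs_of_pos (by positivity)]
  nlinarith

/-- `|0| + |±2√3/3| ≤ 2`. -/
theorem abs_coeff_le_two' (ε : ℝ) (hε : ε = 1 ∨ ε = -1) : |(0 : ℝ)| + |ε * (2 * Real.sqrt 3 / 3)| ≤ 2 := by
  have h3 : Real.sqrt 3 * Real.sqrt 3 = 3 := Real.mul_self_sqrt (by norm_num)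
  have h1 : (1 : ℝ) ≤ Real.sqrt 3 := by
    rw [show (1 : ℝ) = Real.sqrt 1 by simp]
    exact Real.sqrt_le_sqrt (by norm_num)
  have hε1 : |ε| = 1 := by rcases hε with h | h <;> simp [h]
  rw [abs_zero, abs_mul, hε1, one_mul, abs_of_pos (by positivity)]
  nlinarith

end Summit.QuantumFields.YangMills.Cruxes.ShortRootRigidity.AngularTypeRungs

end
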